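import Mathlib.RepresentationTheory.Continuous.TopRep
import Mathlib.RepresentationTheory.Continuous.Basic
import Mathlib.RepresentationTheory.Irreducible
import Mathlib.RepresentationTheory.Semisimple
import Mathlib.RepresentationTheory.Invariants
import Mathlib.RepresentationTheory.Intertwining
import Mathlib.LinearAlgebra.Matrix.GeneralLinearGroup.Defs
import Mathlib.LinearAlgebra.Matrix.Action
import Mathlib.LinearAlgebra.Charpoly.Basic
import Mathlib.Topology.Algebra.ContinuousMonoidHom
import Mathlib.Topology.Algebra.Group.Matrix
import Mathlib.Topology.Instances.Matrix
import Mathlib.Topology.Algebra.Module.ModuleTopology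
import HarnessLib

-- provenance: harness21/H21/H21/Prelude/GalRep/ContinuousRep.lean @ bd548d0 (interim HEAD d8f2665); M5 mechanical rewrite
/-!
# Continuous representations of topological groups (GalRep trunk, item C5 = `G09:ContinuousRep`)

This file is the core carrier for the `galois_representation_l_adic` notion of the GalRep trunk:
continuous representations `ρ : G → GL(M)` of a topological group `G` on a topological module `M`
over a topological commutative ring `A`, together with the *framed* avatar
`G →ₜ* GL (Fin n) A`.

## Main definitions

* `Literature.ContinuousRep G A M`: a representation `Representation A G M` (Mathlib) together with the
  *joint* continuity of `G × M → M`, `(g, v) ↦ ρ g v`.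
* `Literature.NumberTheory.GaloisRepresentations.ContinuousRep.toContRepresentation`, `Literature.NumberTheory.GaloisRepresentations.ContinuousRep.toTopRep`: the forgetful maps to
  Mathlib's `ContRepresentation A G M` (`RepresentationTheory/Continuous/Basic.lean`) and to the
  category `TopRep A G` (`RepresentationTheory/Continuous/TopRep.lean`), so that Mathlib's
  continuous-cohomology API applies.
* `Literature.NumberTheory.GaloisRepresentations.ContinuousRep.restrict`: restriction along a continuous group homomorphism `φ : H →ₜ* G`
  (the analogue of Mathlib's `ContRepresentation.restrict` and `TopRep.res`, and of FLT's
  `GaloisRep.map`).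
* `Literature.NumberTheory.GaloisRepresentations.ContinuousRep.trivial`, `invariants`, `ker`, `IsIrreducible`, `IsSemisimple`,
  `Literature.NumberTheory.GaloisRepresentations.ContinuousRep.Equiv` (a `Representation.Equiv` which is a homeomorphism).
* `Literature.FramedRep G A n := G →ₜ* GL (Fin n) A` and its API: `toContinuousRep`, `charpoly`, `trace`,
  `det`, `dual` (inverse-transpose), `baseChange`, `conj`, `IsAbsolutelyIrreducible`.
* `Literature.NumberTheory.GaloisRepresentations.ContinuousRep.exists_framedRep`: a continuous representation of a group with continuous
  inversion (`[ContinuousInv G]`) on a finite free module with its module topology admits a frame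
  (proof deferred). The hypothesis `ContinuousInv G` is necessary: `GL (Fin n) A` carries the
  *units* topology, so a framed `ρ'` has `g ↦ (ρ' g)⁻¹` continuous, which joint continuity of
  `G × M → M` alone does not give.

## Mathlib declarations used rather than redefined

`Representation`, `Representation.trivial`, `Representation.invariants`,
`Representation.ofDistribMulAction` (with `Matrix.Action`'s `Module (Matrix n n R) (n → R)`: the
standard representation of `GL ι A` on `ι → A`),
`Representation.IsIrreducible`, `Representation.IsSemisimpleRepresentation`,
`Representation.IntertwiningMap`, `Representation.Equiv`, `ContRepresentation`,
`ContIntertwiningMap`, `TopRep.of`, `ContinuousMonoidHom` (`→ₜ*`), `Matrix.GeneralLinearGroup`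
(with its units topology, `Matrix.GeneralLinearGroup.continuous_det`,
`Continuous.generalLinearGroup_map`), `Matrix.charpoly`, `Matrix.trace`, `IsModuleTopology`.
Morphisms of continuous representations are *not* redefined: use
`Representation.IntertwiningMap ρ.toRepresentation ρ'.toRepresentation` (algebraic) or
`ContIntertwiningMap ρ.toContRepresentation ρ'.toContRepresentation` (continuous).

## Design notes

* **Why not Mathlib's `ContRepresentation`?** `ContRepresentation R G V` is `G →* (V →L[R] V)` and
  records no continuity in `G`; the compact-open/operator topology on `V →L[R] V` in Mathlib needs a
  normed field `R`. For general topological coefficient rings (`ℤ_[ℓ]`, discrete `𝔽̄_p`, complete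
  local rings) we therefore record joint continuity of `G × M → M` directly (outline GalRep, D1).
  For `M = Fin n → A` with the product topology this agrees with continuity of
  `G → GL (Fin n) A`.
* **Topology-on-`M` rule (outline GalRep D1).** `[TopologicalSpace M]` is *data*, and for the
  indiscrete topology on `M` the continuity condition is vacuous. Hence every theorem in this
  trunk quantifying over an arbitrary module `M`, and every downstream target statement, assumes
  `[IsModuleTopology A M]` (`Mathlib/Topology/Algebra/Module/ModuleTopology.lean`;
  `IsModuleTopology.instPi` provides it for `Fin n → A`, and
  `IsTopologicalSemiring.toIsModuleTopology` for `M = A`), or is phrased for `FramedRep G A n`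
  (topology of `GL (Fin n) A`, no choice).
* **Duals.** `Module.Dual A M` carries no topology instance in Mathlib, so the contragredient is
  only defined on framed representations (`FramedRep.dual`, inverse-transpose), with a genuine
  continuity proof.
* **Absolute irreducibility** is defined on framed representations, purely algebraically, by
  quantifying over field extensions `B` *in the same universe as `A`*.

## References

* J.-P. Serre, *Abelian ℓ-adic representations and elliptic curves* (1968), Ch. I §1.
* FLT project (K. Buzzard et al.), `FLT/Deformations/RepresentationTheory/GaloisRep.lean`
  (names `GaloisRep.map`, `GaloisRep.conj`, `GaloisRep.det`, `GaloisRep.baseChange`, framed reps).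
* Mathlib `RepresentationTheory/Continuous/Basic.lean` (`ContRepresentation.restrict`),
  `RepresentationTheory/Continuous/TopRep.lean` (`TopRep.res`).
-/

namespace Literature.NumberTheory.GaloisRepresentations

universe u v w w'

open Topology Matrix

/-- A **continuous representation** of a topological group `G` on a topological `A`-module `M`:
an `A`-linear representation `toRepresentation : Representation A G M` such that the action map
`G × M → M`, `(g, v) ↦ ρ g v`, is jointly continuous.
(Serre, *Abelian ℓ-adic representations*, Ch. I §1.1; FLT `GaloisRep`.) [folklore] -/
structure ContinuousRep (G : Type u) (A : Type v) (M : Type w) [Group G] [TopologicalSpace G]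
    [CommRing A] [TopologicalSpace A] [AddCommGroup M] [Module A M] [TopologicalSpace M] where
  /-- The underlying `A`-linear representation. -/
  toRepresentation : Representation A G M
  /-- The action map `(g, v) ↦ ρ g v` is jointly continuous. -/
  continuous_smul : Continuous fun p : G × M => toRepresentation p.1 p.2

namespace ContinuousRep

section CommRing

variable {G : Type u} {A : Type v} {M : Type w} {N : Type w'} [Group G] [TopologicalSpace G]
  [CommRing A] [TopologicalSpace A] [AddCommGroup M] [Module A M] [TopologicalSpace M]
  [AddCommGroup N] [Module A N] [TopologicalSpace N]

/-- A continuous representation is a function `G → (M →ₗ[A] M)` (FLT `GaloisRep` coercion). [folklore] -/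
instance instFunLike : FunLike (ContinuousRep G A M) G (M →ₗ[A] M) where
  coe ρ := ρ.toRepresentation
  coe_injective ρ₁ ρ₂ h := by
    cases ρ₁; cases ρ₂; congr; exact DFunLike.coe_injective h

/-- A continuous representation is a monoid homomorphism `G →* (M →ₗ[A] M)`. [folklore] -/
instance instMonoidHomClass : MonoidHomClass (ContinuousRep G A M) G (M →ₗ[A] M) where
  map_one ρ := ρ.toRepresentation.map_one
  map_mul ρ := ρ.toRepresentation.map_mul

/-- The coercion of the underlying representation agrees with the coercion of `ρ`. [folklore] -/
@[simp] lemma coe_toRepresentation (ρ : ContinuousRep G A M) : ⇑ρ.toRepresentation = ρ := rfl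

/-- Unfolding lemma for the underlying representation. [folklore] -/
lemma toRepresentation_apply (ρ : ContinuousRep G A M) (g : G) : ρ.toRepresentation g = ρ g :=
  rfl

/-- The underlying representation determines the continuous representation. [folklore] -/
lemma toRepresentation_injective :
    Function.Injective (toRepresentation : ContinuousRep G A M → Representation A G M) :=
  fun ρ₁ ρ₂ h => by cases ρ₁; cases ρ₂; congr

/-- Two continuous representations are equal if they agree on every group element. [folklore] -/
@[ext] theorem ext {ρ ρ' : ContinuousRep G A M} (h : ∀ g, ρ g = ρ' g) : ρ = ρ' :=
  DFunLike.ext _ _ h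

/-- Joint continuity of the action map, in coercion form. [folklore] -/
lemma continuous_apply₂ (ρ : ContinuousRep G A M) : Continuous fun p : G × M => ρ p.1 p.2 :=
  ρ.continuous_smul

/-- Each operator `ρ g : M → M` is continuous. [folklore] -/
lemma continuous_apply (ρ : ContinuousRep G A M) (g : G) : Continuous (ρ g) :=
  ρ.continuous_smul.comp (continuous_const.prodMk continuous_id)

/-- Each orbit map `g ↦ ρ g v` is continuous. [folklore] -/
lemma continuous_apply_left (ρ : ContinuousRep G A M) (v : M) : Continuous fun g => ρ g v :=
  ρ.continuous_smul.comp (continuous_id.prodMk continuous_const)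

/-! ### Comparison with Mathlib's `ContRepresentation` and `TopRep` -/

/-- The Mathlib continuous representation `G →* (M →L[A] M)` underlying `ρ` (forgetting continuity
in `G`). Each `ρ g` is continuous by `ContinuousRep.continuous_apply`.
(Mathlib `ContRepresentation`, `RepresentationTheory/Continuous/Basic.lean`.) [folklore] -/
def toContRepresentation [IsTopologicalAddGroup M] (ρ : ContinuousRep G A M) :
    ContRepresentation A G M :=
  .ofMonoidHom
    { toFun := fun g => ⟨ρ g, ρ.continuous_apply g⟩
      map_one' := by ext; simp
      map_mul' := fun g h => by ext; simp }

/-- Unfolding lemma for `toContRepresentation`. [folklore] -/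
@[simp] lemma toContRepresentation_apply_apply [IsTopologicalAddGroup M] (ρ : ContinuousRep G A M)
    (g : G) (v : M) : ρ.toContRepresentation g v = ρ g v := rfl

/-- The continuous linear map `ρ.toContRepresentation g` has underlying linear map `ρ g`. [folklore] -/
@[simp] lemma toContRepresentation_apply_toLinearMap [IsTopologicalAddGroup M]
    (ρ : ContinuousRep G A M) (g : G) :
    (ρ.toContRepresentation g).toLinearMap = ρ g := rfl

/-- `toContRepresentation` is compatible with the underlying `Representation`. [folklore] -/
lemma toContRepresentation_toRepresentation [IsTopologicalAddGroup M] (ρ : ContinuousRep G A M) :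
    ρ.toContRepresentation.toRepresentation = ρ.toRepresentation := rfl

/-- The object of Mathlib's category `TopRep A G` of topological representations attached to `ρ`.
(Mathlib `TopRep.of`, `RepresentationTheory/Continuous/TopRep.lean`.) [folklore] -/
abbrev toTopRep [IsTopologicalAddGroup M] [ContinuousSMul A M] (ρ : ContinuousRep G A M) :
    TopRep.{w} A G :=
  TopRep.of ρ.toContRepresentation

/-! ### Restriction along a continuous homomorphism -/

/-- Restriction (pull-back) of a continuous representation along a continuous group homomorphism
`φ : H →ₜ* G`: `h ↦ ρ (φ h)`. This is FLT's `GaloisRep.map` and the analogue of Mathlib's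
`ContRepresentation.restrict` (`RepresentationTheory/Continuous/Basic.lean`) and `TopRep.res`
(`RepresentationTheory/Continuous/TopRep.lean`), which restrict along a bare `MonoidHom`. To
restrict along a bare `φ : H →* G` with a continuity proof `hφ`, use `ρ.restrict ⟨φ, hφ⟩`. [folklore] -/
def restrict {H : Type*} [Group H] [TopologicalSpace H] (ρ : ContinuousRep G A M) (φ : H →ₜ* G) :
    ContinuousRep H A M where
  toRepresentation := ρ.toRepresentation.comp φ.toMonoidHom
  continuous_smul :=
    ρ.continuous_smul.comp (((map_continuous φ).comp continuous_fst).prodMk continuous_snd)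

/-- Unfolding lemma for `restrict`. [folklore] -/
@[simp] lemma restrict_apply {H : Type*} [Group H] [TopologicalSpace H] (ρ : ContinuousRep G A M)
    (φ : H →ₜ* G) (h : H) : ρ.restrict φ h = ρ (φ h) := rfl

/-- The representation underlying a restriction. [folklore] -/
lemma toRepresentation_restrict {H : Type*} [Group H] [TopologicalSpace H]
    (ρ : ContinuousRep G A M) (φ : H →ₜ* G) :
    (ρ.restrict φ).toRepresentation = ρ.toRepresentation.comp φ.toMonoidHom := rfl

/-- Restriction along the identity. [folklore] -/
@[simp] lemma restrict_id (ρ : ContinuousRep G A M) :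
    ρ.restrict (ContinuousMonoidHom.id G) = ρ := rfl

/-- Restriction is functorial: restricting along `ψ` then `φ` is restricting along `ψ ∘ φ`. [folklore] -/
lemma restrict_comp {H K : Type*} [Group H] [TopologicalSpace H] [Group K] [TopologicalSpace K]
    (ρ : ContinuousRep G A M) (ψ : H →ₜ* G) (φ : K →ₜ* H) :
    (ρ.restrict ψ).restrict φ = ρ.restrict (ψ.comp φ) := rfl

/-- `toContRepresentation` commutes with restriction (Mathlib `ContRepresentation.restrict`). [folklore] -/
lemma toContRepresentation_restrict [IsTopologicalAddGroup M] {H : Type*} [Group H]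
    [TopologicalSpace H] (ρ : ContinuousRep G A M) (φ : H →ₜ* G) :
    (ρ.restrict φ).toContRepresentation = ρ.toContRepresentation.restrict φ.toMonoidHom :=
  DFunLike.ext _ _ fun _ => rfl

/-! ### Trivial representation, invariants, kernel -/

variable (G A M) in
/-- The trivial continuous representation: every `g` acts as the identity.
(Mathlib `Representation.trivial`.) [folklore] -/
def trivial : ContinuousRep G A M where
  toRepresentation := Representation.trivial A G M
  continuous_smul := continuous_snd

/-- Unfolding lemma for the trivial representation. [folklore] -/
@[simp] lemma trivial_apply (g : G) (v : M) : trivial G A M g v = v := rfl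

/-- The submodule `M^G` of `G`-invariant vectors (Mathlib `Representation.invariants`). [folklore] -/
noncomputable def invariants (ρ : ContinuousRep G A M) : Submodule A M := ρ.toRepresentation.invariants

/-- Membership in the invariants. [folklore] -/
@[simp] lemma mem_invariants (ρ : ContinuousRep G A M) (v : M) :
    v ∈ ρ.invariants ↔ ∀ g : G, ρ g v = v := Iff.rfl

/-- The kernel of a continuous representation, a subgroup of `G` (`MonoidHom.ker` of the
underlying representation). [folklore] -/
def ker (ρ : ContinuousRep G A M) : Subgroup G := ρ.toRepresentation.ker

/-- Membership in the kernel. [folklore] -/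
@[simp] lemma mem_ker (ρ : ContinuousRep G A M) (g : G) : g ∈ ρ.ker ↔ ρ g = LinearMap.id :=
  Iff.rfl

/-- The kernel of a continuous representation on a Hausdorff module is closed. [folklore] -/
theorem isClosed_ker [T2Space M] (ρ : ContinuousRep G A M) : IsClosed (ρ.ker : Set G) := by
  have : (ρ.ker : Set G) = ⋂ v : M, {g | ρ g v = v} := by
    ext g; simp [LinearMap.ext_iff, Set.mem_iInter]
  rw [this]
  exact isClosed_iInter fun v => isClosed_eq (ρ.continuous_apply_left v) continuous_const

/-! ### Equivalences -/

/-- An **equivalence of continuous representations** `ρ ≃ ρ'`: a `G`-equivariant `A`-linear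
isomorphism (Mathlib `Representation.Equiv`, `RepresentationTheory/Intertwining.lean`) which is
moreover a homeomorphism. Plain morphisms are Mathlib's `Representation.IntertwiningMap` /
`ContIntertwiningMap`; no new Hom type is introduced. [folklore] -/
structure Equiv (ρ : ContinuousRep G A M) (ρ' : ContinuousRep G A N) extends
    toRepEquiv : Representation.Equiv ρ.toRepresentation ρ'.toRepresentation where
  /-- The forward map is continuous. -/
  continuous_toFun : Continuous toFun
  /-- The inverse map is continuous. -/
  continuous_invFun : Continuous invFun

namespace Equiv

variable {ρ : ContinuousRep G A M} {ρ' : ContinuousRep G A N}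

/-- The homeomorphism underlying an equivalence of continuous representations. [folklore] -/
def toHomeomorph (e : Equiv ρ ρ') : M ≃ₜ N where
  toEquiv := e.toLinearEquiv.toEquiv
  continuous_toFun := e.continuous_toFun
  continuous_invFun := e.continuous_invFun

/-- The continuous linear isomorphism underlying an equivalence of continuous representations. [folklore] -/
def toContinuousLinearEquiv (e : Equiv ρ ρ') : M ≃L[A] N where
  toLinearEquiv := e.toLinearEquiv
  continuous_toFun := e.continuous_toFun
  continuous_invFun := e.continuous_invFun

/-- Unfolding lemma for `toHomeomorph`. [folklore] -/
@[simp] lemma toHomeomorph_apply (e : Equiv ρ ρ') (v : M) :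
    e.toHomeomorph v = e.toLinearEquiv v := rfl

/-- Unfolding lemma for `toContinuousLinearEquiv`. [folklore] -/
@[simp] lemma toContinuousLinearEquiv_apply (e : Equiv ρ ρ') (v : M) :
    e.toContinuousLinearEquiv v = e.toLinearEquiv v := rfl

/-- Equivariance of an equivalence, pointwise. [folklore] -/
lemma apply_apply (e : Equiv ρ ρ') (g : G) (v : M) :
    e.toLinearEquiv (ρ g v) = ρ' g (e.toLinearEquiv v) :=
  congr($(e.isIntertwining' g) v)

variable (ρ) in
/-- The identity equivalence. [folklore] -/
def refl : Equiv ρ ρ where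
  __ := Representation.Equiv.refl ρ.toRepresentation
  continuous_toFun := continuous_id
  continuous_invFun := continuous_id

/-- The inverse equivalence. [folklore] -/
def symm (e : Equiv ρ ρ') : Equiv ρ' ρ where
  __ := e.toRepEquiv.symm
  continuous_toFun := e.continuous_invFun
  continuous_invFun := e.continuous_toFun

variable {P : Type*} [AddCommGroup P] [Module A P] [TopologicalSpace P] {ρ'' : ContinuousRep G A P}
  in
/-- Composition of equivalences (Mathlib `Representation.Equiv.trans`). [folklore] -/
def trans (e : Equiv ρ ρ') (e' : Equiv ρ' ρ'') : Equiv ρ ρ'' where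
  __ := e.toRepEquiv.trans e'.toRepEquiv
  continuous_toFun := e'.continuous_toFun.comp e.continuous_toFun
  continuous_invFun := e.continuous_invFun.comp e'.continuous_invFun

end Equiv

end CommRing

/-! ### Irreducibility and semisimplicity (field coefficients) -/

section Field

variable {G : Type u} {A : Type v} {M : Type w} [Group G] [TopologicalSpace G]
  [Field A] [TopologicalSpace A] [AddCommGroup M] [Module A M] [TopologicalSpace M]

/-- A continuous representation over a field is **irreducible** if its underlying (algebraic)
representation is, i.e. the lattice of subrepresentations is simple
(Mathlib `Representation.IsIrreducible`). Note: this is algebraic irreducibility; for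
finite-dimensional Hausdorff `M` every subrepresentation is closed, so it agrees with topological
irreducibility. [folklore] -/
protected abbrev IsIrreducible (ρ : ContinuousRep G A M) : Prop := ρ.toRepresentation.IsIrreducible

/-- A continuous representation over a field is **semisimple** if its underlying representation
is (every subrepresentation has a complement; Mathlib `Representation.IsSemisimpleRepresentation`).
[folklore] -/
protected abbrev IsSemisimple (ρ : ContinuousRep G A M) : Prop :=
  ρ.toRepresentation.IsSemisimpleRepresentation

end Field

end ContinuousRep

/-! ### Framed representations `G →ₜ* GL (Fin n) A` -/

section GLStd

/-- The standard (tautological) representation of `GL ι A` on column vectors `ι → A`,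
`g ↦ (v ↦ g *ᵥ v)`. This *is* Mathlib's `Representation.ofDistribMulAction A (GL ι A) (ι → A)`
(`RepresentationTheory/Basic.lean`) for the action `Module (Matrix ι ι A) (ι → A)` of
`Mathlib/LinearAlgebra/Matrix/Action.lean` restricted to units; we only give it a name
(cf. also `Matrix.GeneralLinearGroup.toLin`). [folklore] -/
abbrev glStdRepresentation (ι : Type*) [Fintype ι] [DecidableEq ι] (A : Type v) [CommRing A] :
    Representation A (GL ι A) (ι → A) :=
  Representation.ofDistribMulAction A (GL ι A) (ι → A)

/-- Unfolding lemma for the standard representation (not `@[simp]`: since `glStdRepresentation` is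
an `abbrev`, `dsimp` already unfolds the left-hand side via
`Representation.ofDistribMulAction_apply_apply`). [folklore] -/
lemma glStdRepresentation_apply {ι : Type*} [Fintype ι] [DecidableEq ι] {A : Type v}
    [CommRing A] (g : GL ι A)
    (v : ι → A) : glStdRepresentation ι A g v = (g : Matrix ι ι A) *ᵥ v := rfl

end GLStd

section Framed

variable (G : Type u) (A : Type v) [Group G] [TopologicalSpace G] [CommRing A] [TopologicalSpace A]

/-- A **framed** continuous representation of rank `n`: a continuous group homomorphism
`G →ₜ* GL (Fin n) A` (Mathlib `ContinuousMonoidHom` into `Matrix.GeneralLinearGroup`, with the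
units topology induced from `Matrix (Fin n) (Fin n) A`). This is FLT's framed `GaloisRep`. [folklore] -/
abbrev FramedRep (n : ℕ) : Type (max u v) := G →ₜ* GL (Fin n) A

variable {G A}

namespace FramedRep

variable {n : ℕ}

/-- The (algebraic) representation of `G` on `Fin n → A` underlying a framed representation. [folklore] -/
def toRepresentation (ρ : FramedRep G A n) : Representation A G (Fin n → A) :=
  (glStdRepresentation (Fin n) A).comp ρ.toMonoidHom

/-- Unfolding lemma for `FramedRep.toRepresentation`. [folklore] -/
@[simp] lemma toRepresentation_apply_apply (ρ : FramedRep G A n) (g : G) (v : Fin n → A) :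
    ρ.toRepresentation g v = ((ρ g : GL (Fin n) A) : Matrix (Fin n) (Fin n) A) *ᵥ v := rfl

/-- A framed representation `G →ₜ* GL (Fin n) A` over a topological ring is a continuous
representation on `Fin n → A` (product topology, which is the module topology by
`IsModuleTopology.instPi`). Continuity: `(g, v) ↦ (ρ g) *ᵥ v` is continuous since matrix entries
of `ρ g` and `*ᵥ` are. (FLT `GaloisRep.ofFramed`.) [folklore] -/
def toContinuousRep [IsTopologicalRing A] (ρ : FramedRep G A n) : ContinuousRep G A (Fin n → A) where
  toRepresentation := ρ.toRepresentation
  continuous_smul :=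
    show Continuous fun p : G × (Fin n → A) =>
      ((ρ p.1 : GL (Fin n) A) : Matrix (Fin n) (Fin n) A) *ᵥ p.2 from
    (Units.continuous_val.comp ((map_continuous ρ).comp continuous_fst)).matrix_mulVec
      continuous_snd

/-- Unfolding lemma for `FramedRep.toContinuousRep`. [folklore] -/
@[simp] lemma toContinuousRep_apply_apply [IsTopologicalRing A] (ρ : FramedRep G A n) (g : G)
    (v : Fin n → A) :
    ρ.toContinuousRep g v = ((ρ g : GL (Fin n) A) : Matrix (Fin n) (Fin n) A) *ᵥ v := rfl

/-- The representation underlying `toContinuousRep`. [folklore] -/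
lemma toContinuousRep_toRepresentation [IsTopologicalRing A] (ρ : FramedRep G A n) :
    ρ.toContinuousRep.toRepresentation = ρ.toRepresentation := rfl

/-- The characteristic polynomial `det (X - ρ g)` of `ρ g` (Mathlib `Matrix.charpoly`). [folklore] -/
noncomputable def charpoly (ρ : FramedRep G A n) (g : G) : Polynomial A :=
  ((ρ g : GL (Fin n) A) : Matrix (Fin n) (Fin n) A).charpoly

/-- The trace of `ρ g` (Mathlib `Matrix.trace`). [folklore] -/
def trace (ρ : FramedRep G A n) (g : G) : A :=
  ((ρ g : GL (Fin n) A) : Matrix (Fin n) (Fin n) A).trace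

/-- The trace as a function is continuous. [folklore] -/
lemma continuous_trace [IsTopologicalRing A] (ρ : FramedRep G A n) : Continuous ρ.trace :=
  (Units.continuous_val.comp (map_continuous ρ)).matrix_trace

/-- The determinant character `g ↦ det (ρ g)` as a continuous homomorphism `G →ₜ* Aˣ`
(Mathlib `Matrix.GeneralLinearGroup.det`, `Matrix.GeneralLinearGroup.continuous_det`;
FLT `GaloisRep.det`). [folklore] -/
def det [IsTopologicalRing A] (ρ : FramedRep G A n) : G →ₜ* Aˣ :=
  ContinuousMonoidHom.comp
    ⟨Matrix.GeneralLinearGroup.det, Matrix.GeneralLinearGroup.continuous_det⟩ ρ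

/-- Unfolding lemma for `FramedRep.det`. [folklore] -/
@[simp] lemma det_apply [IsTopologicalRing A] (ρ : FramedRep G A n) (g : G) :
    ρ.det g = Matrix.GeneralLinearGroup.det (ρ g) := rfl

end FramedRep

/-- Inverse-transpose `g ↦ (gᵀ)⁻¹ = (g⁻¹)ᵀ` as a continuous group homomorphism
`GL ι A →ₜ* GL ι A`. Continuity is proved from `Units.continuous_iff` and continuity of
transpose (`Continuous.matrix_transpose`) and of `Units.val`, `Units.coe_inv`. [folklore] -/
def glTransposeInv (ι : Type*) [Fintype ι] [DecidableEq ι] (A : Type v) [CommRing A]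
    [TopologicalSpace A] : GL ι A →ₜ* GL ι A where
  toFun g :=
    ⟨((g⁻¹ : GL ι A) : Matrix ι ι A)ᵀ, (g : Matrix ι ι A)ᵀ,
      by rw [← Matrix.transpose_mul]; simp, by rw [← Matrix.transpose_mul]; simp⟩
  map_one' := Units.ext <| by simp
  map_mul' g h := Units.ext <| by simp [Matrix.transpose_mul, _root_.mul_inv_rev]
  continuous_toFun :=
    Units.continuous_iff.2
      ⟨Units.continuous_coe_inv.matrix_transpose, Units.continuous_val.matrix_transpose⟩

/-- Unfolding lemma for `glTransposeInv` (as a matrix). [folklore] -/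
@[simp] lemma coe_glTransposeInv_apply {ι : Type*} [Fintype ι] [DecidableEq ι] (g : GL ι A) :
    ((glTransposeInv ι A g : GL ι A) : Matrix ι ι A) = ((g⁻¹ : GL ι A) : Matrix ι ι A)ᵀ := rfl

namespace FramedRep

variable {n : ℕ}

/-- The **dual** (contragredient) framed representation `g ↦ ((ρ g)ᵀ)⁻¹`
(Serre, *Linear representations of finite groups*, §1.4; replaces a dual on abstract `M`, since
`Module.Dual A M` has no topology in Mathlib). [folklore] -/
def dual (ρ : FramedRep G A n) : FramedRep G A n := (glTransposeInv (Fin n) A).comp ρ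

/-- Unfolding lemma for `FramedRep.dual` (as a matrix). [folklore] -/
@[simp] lemma coe_dual_apply (ρ : FramedRep G A n) (g : G) :
    ((ρ.dual g : GL (Fin n) A) : Matrix (Fin n) (Fin n) A) =
      (((ρ g)⁻¹ : GL (Fin n) A) : Matrix (Fin n) (Fin n) A)ᵀ := rfl

/-- **Base change** of a framed representation along a continuous ring homomorphism `f : A →+* B`:
`g ↦ (ρ g).map f` (Mathlib `Matrix.GeneralLinearGroup.map`, `Continuous.generalLinearGroup_map`;
FLT `GaloisRep.baseChange`). [folklore] -/
def baseChange {B : Type*} [CommRing B] [TopologicalSpace B] (f : A →+* B) (hf : Continuous f)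
    (ρ : FramedRep G A n) : FramedRep G B n :=
  ContinuousMonoidHom.comp ⟨Matrix.GeneralLinearGroup.map f, hf.generalLinearGroup_map⟩ ρ

/-- Unfolding lemma for `FramedRep.baseChange`. [folklore] -/
@[simp] lemma baseChange_apply {B : Type*} [CommRing B] [TopologicalSpace B] (f : A →+* B)
    (hf : Continuous f) (ρ : FramedRep G A n) (g : G) :
    ρ.baseChange f hf g = Matrix.GeneralLinearGroup.map f (ρ g) := rfl

/-- The purely algebraic base change of a framed representation along `f : A →+* B` (no topology
on `B`): the `B`-representation `g ↦ (v ↦ ((ρ g).map f) *ᵥ v)` on `Fin n → B`. When `B` is a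
topological ring and `f` is continuous this is the representation underlying
`FramedRep.baseChange` (`toRepresentation_baseChange`). [folklore] -/
def baseChangeRepresentation {B : Type*} [CommRing B] (f : A →+* B) (ρ : FramedRep G A n) :
    Representation B G (Fin n → B) :=
  (glStdRepresentation (Fin n) B).comp ((Matrix.GeneralLinearGroup.map f).comp ρ.toMonoidHom)

/-- Unfolding lemma for `FramedRep.baseChangeRepresentation`. [folklore] -/
@[simp] lemma baseChangeRepresentation_apply_apply {B : Type*} [CommRing B] (f : A →+* B)
    (ρ : FramedRep G A n) (g : G) (v : Fin n → B) :
    ρ.baseChangeRepresentation f g v =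
      ((Matrix.GeneralLinearGroup.map f (ρ g) : GL (Fin n) B) : Matrix (Fin n) (Fin n) B) *ᵥ v :=
  rfl

/-- The representation underlying the topological base change is the algebraic base change. [folklore] -/
lemma toRepresentation_baseChange {B : Type*} [CommRing B] [TopologicalSpace B] (f : A →+* B)
    (hf : Continuous f) (ρ : FramedRep G A n) :
    (ρ.baseChange f hf).toRepresentation = ρ.baseChangeRepresentation f := rfl

/-- Base change along the identity is the original representation. [folklore] -/
@[simp] lemma baseChangeRepresentation_id (ρ : FramedRep G A n) :
    ρ.baseChangeRepresentation (RingHom.id A) = ρ.toRepresentation := by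
  refine MonoidHom.ext fun g => LinearMap.ext fun v => ?_
  simp [baseChangeRepresentation, toRepresentation]

/-- **Conjugation** of a framed representation by `P ∈ GL (Fin n) A`: `g ↦ P (ρ g) P⁻¹`
(change of frame; FLT `GaloisRep.conj`). [folklore] -/
def conj [IsTopologicalRing A] (P : GL (Fin n) A) (ρ : FramedRep G A n) : FramedRep G A n where
  toMonoidHom := (MulAut.conj P).toMonoidHom.comp ρ.toMonoidHom
  continuous_toFun :=
    show Continuous fun g => P * ρ g * P⁻¹ from
    (continuous_const.mul (map_continuous ρ)).mul continuous_const

/-- Unfolding lemma for `FramedRep.conj`. [folklore] -/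
@[simp] lemma conj_apply [IsTopologicalRing A] (P : GL (Fin n) A) (ρ : FramedRep G A n) (g : G) :
    ρ.conj P g = P * ρ g * P⁻¹ := rfl

end FramedRep

end Framed

section FramedField

variable {G : Type u} {A : Type v} [Group G] [TopologicalSpace G] [Field A] [TopologicalSpace A]
  {n : ℕ}

/-- A framed representation over a field `A` is **absolutely irreducible** if for every field
`B` (in the same universe `Type v` as `A`) and every ring homomorphism `f : A →+* B`, the
base-changed `B`-representation `g ↦ (ρ g).map f` on `Fin n → B` is irreducible
(Mathlib `Representation.IsIrreducible`). Purely algebraic: no topology on `B` is involved.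
(Curtis–Reiner, *Methods of Representation Theory* I, §3B.) [folklore] -/
def FramedRep.IsAbsolutelyIrreducible (ρ : FramedRep G A n) : Prop :=
  ∀ (B : Type v) [Field B] (f : A →+* B), (ρ.baseChangeRepresentation f).IsIrreducible

/-- A framed representation over a field is **irreducible** if its underlying (algebraic)
representation on `Fin n → A` is (Mathlib `Representation.IsIrreducible`). No topological
hypothesis is needed; when `[IsTopologicalRing A]` this is definitionally
`ρ.toContinuousRep.IsIrreducible`. [folklore] -/
protected abbrev FramedRep.IsIrreducible (ρ : FramedRep G A n) : Prop :=
  ρ.toRepresentation.IsIrreducible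

/-- Compatibility of the two irreducibility predicates on framed representations. [folklore] -/
lemma FramedRep.isIrreducible_toContinuousRep_iff [IsTopologicalRing A] (ρ : FramedRep G A n) :
    ρ.toContinuousRep.IsIrreducible ↔ ρ.IsIrreducible := Iff.rfl

/-- An absolutely irreducible framed representation is irreducible (take `B := A`,
`f := RingHom.id A`); a non-vacuity sanity check. [folklore] -/
lemma FramedRep.IsAbsolutelyIrreducible.isIrreducible {ρ : FramedRep G A n}
    (h : ρ.IsAbsolutelyIrreducible) : ρ.IsIrreducible := by
  have := h A (RingHom.id A)
  rwa [baseChangeRepresentation_id] at this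

end FramedField

/-! ### Existence of frames -/

section Exists

variable {G : Type u} {A : Type v} {M : Type w} [Group G] [TopologicalSpace G]
  [CommRing A] [TopologicalSpace A] [IsTopologicalRing A]
  [AddCommGroup M] [Module A M] [TopologicalSpace M]

/-- A continuous representation on a finite free `A`-module `M` carrying the module topology is
equivalent (as a continuous representation) to the continuous representation attached to a framed
representation `G →ₜ* GL (Fin n) A`, `n = rank M`: choose a basis; the coordinate isomorphism
`M ≃ₗ[A] (Fin n → A)` is a homeomorphism for the module topologies
(`IsModuleTopology.continuous_of_linearMap`), and continuity of `G → GL (Fin n) A` follows from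
joint continuity by evaluating at basis vectors, together with continuity of inversion on `G`:
`GL (Fin n) A` carries the units topology (embedding `u ↦ (u, u⁻¹)`), so one also needs
`g ↦ (ρ g⁻¹ : Matrix)` continuous, which is where `[ContinuousInv G]` enters (without it the
statement is false, e.g. for `G = Aˣ` with the subspace topology of a topological ring whose unit
group has discontinuous inversion, acting on `M = A`). All groups downstream (absolute Galois
groups, Weil groups) are topological groups. (Standard; cf. FLT `GaloisRep.frame`.) [folklore] -/
def ContinuousRep.exists_framedRep : Prop :=
  ∀ [ContinuousInv G] [Module.Free A M] [Module.Finite A M] [IsModuleTopology A M] (ρ : ContinuousRep G A M),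
    ∃ (n : ℕ) (ρ' : FramedRep G A n), Nonempty (ContinuousRep.Equiv ρ'.toContinuousRep ρ)

end Exists

/-! ### Existence of frames: proof

Discharge of `Literature.NumberTheory.GaloisRepresentations.ContinuousRep.exists_framedRep` (folklore; cf. FLT `GaloisRep.frame`,
Serre, *Abelian ℓ-adic representations and elliptic curves* (1968), Ch. I §1.1). Given a basis
`b : Module.Basis (Fin n) A M`, the frame of `ρ` is `g ↦ LinearMap.toMatrix b b (ρ g) ∈ GL (Fin n) A`;
its continuity for the units topology uses `Units.continuous_iff`, continuity of the coordinate map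
`b.equivFun` (`IsModuleTopology.continuous_of_linearMap`), joint continuity evaluated at the basis
vectors, and `[ContinuousInv G]` for the inverse component. The comparison isomorphism is
`b.equivFun.symm : (Fin n → A) ≃ₗ[A] M`, a homeomorphism for the module topologies. -/

section ExistsProof

variable {G : Type u} {A : Type v} {M : Type w} [Group G] [TopologicalSpace G]
  [CommRing A] [TopologicalSpace A] [IsTopologicalRing A]
  [AddCommGroup M] [Module A M] [TopologicalSpace M] {n : ℕ}

namespace ContinuousRep

/-- The matrix-valued map `g ↦ [ρ g]_b` attached to a basis `b` is continuous when `M` carries the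
module topology: entry `(i, j)` is `b.equivFun (ρ g (b j)) i`. [folklore] -/
lemma continuous_toMatrix [IsModuleTopology A M] (ρ : ContinuousRep G A M)
    (b : Module.Basis (Fin n) A M) :
    Continuous fun g => LinearMap.toMatrix b b (ρ g) := by
  refine continuous_matrix fun i j => ?_
  have hb : Continuous (b.equivFun : M → Fin n → A) :=
    IsModuleTopology.continuous_of_linearMap b.equivFun.toLinearMap
  have : (fun g => LinearMap.toMatrix b b (ρ g) i j) = fun g => b.equivFun (ρ g (b j)) i := by
    ext g; simp [LinearMap.toMatrix_apply, Module.Basis.equivFun_apply]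
  rw [this]
  exact (_root_.continuous_apply i).comp (hb.comp (ρ.continuous_apply_left (b j)))

/-- The **frame** of a continuous representation `ρ` on `M` with respect to a basis
`b : Module.Basis (Fin n) A M`: the framed representation `g ↦ [ρ g]_b : G →ₜ* GL (Fin n) A`, with
inverse component `[ρ g⁻¹]_b`. Continuity of the `GL`-valued map (units topology) uses
`[ContinuousInv G]`. (FLT `GaloisRep.frame`.) [folklore] -/
noncomputable def frame [ContinuousInv G] [IsModuleTopology A M] (ρ : ContinuousRep G A M)
    (b : Module.Basis (Fin n) A M) : FramedRep G A n where
  toFun g :=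
    ⟨LinearMap.toMatrix b b (ρ g), LinearMap.toMatrix b b (ρ g⁻¹),
      by rw [← LinearMap.toMatrix_mul, ← map_mul, mul_inv_cancel, map_one, LinearMap.toMatrix_one],
      by rw [← LinearMap.toMatrix_mul, ← map_mul, inv_mul_cancel, map_one, LinearMap.toMatrix_one]⟩
  map_one' := Units.ext <| by simp [LinearMap.toMatrix_one]
  map_mul' g h := Units.ext <| by simp [LinearMap.toMatrix_mul]
  continuous_toFun :=
    Units.continuous_iff.2
      ⟨ρ.continuous_toMatrix b, (ρ.continuous_toMatrix b).comp continuous_inv⟩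

/-- Unfolding lemma for `ContinuousRep.frame` (as a matrix). [folklore] -/
@[simp] lemma coe_frame_apply [ContinuousInv G] [IsModuleTopology A M] (ρ : ContinuousRep G A M)
    (b : Module.Basis (Fin n) A M) (g : G) :
    ((ρ.frame b g : GL (Fin n) A) : Matrix (Fin n) (Fin n) A) = LinearMap.toMatrix b b (ρ g) := rfl

/-- The coordinate isomorphism `b.equivFun.symm : (Fin n → A) ≃ M` is an equivalence of continuous
representations from the frame `ρ.frame b` (acting on column vectors) to `ρ`; both directions are
continuous because source and target carry the module topology. [folklore] -/
noncomputable def frameEquiv [ContinuousInv G] [IsModuleTopology A M] (ρ : ContinuousRep G A M)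
    (b : Module.Basis (Fin n) A M) : ContinuousRep.Equiv (ρ.frame b).toContinuousRep ρ where
  __ := Representation.Equiv.mk (ρ := (ρ.frame b).toContinuousRep.toRepresentation)
      (σ := ρ.toRepresentation) b.equivFun.symm fun g => LinearMap.ext fun v => by
    obtain ⟨x, rfl⟩ := b.equivFun.surjective v
    change b.equivFun.symm (LinearMap.toMatrix b b (ρ g) *ᵥ b.equivFun x) =
      ρ g (b.equivFun.symm (b.equivFun x))
    rw [Module.Basis.equivFun_apply, LinearMap.toMatrix_mulVec_repr, ← Module.Basis.equivFun_apply,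
      ← Module.Basis.equivFun_apply, LinearEquiv.symm_apply_apply, LinearEquiv.symm_apply_apply]
  continuous_toFun := by
    haveI := IsModuleTopology.toContinuousAdd A M
    exact IsModuleTopology.continuous_of_linearMap b.equivFun.symm.toLinearMap
  continuous_invFun := IsModuleTopology.continuous_of_linearMap b.equivFun.toLinearMap

/-- Unfolding lemma for `ContinuousRep.frameEquiv`. [folklore] -/
@[simp] lemma frameEquiv_toLinearEquiv [ContinuousInv G] [IsModuleTopology A M]
    (ρ : ContinuousRep G A M) (b : Module.Basis (Fin n) A M) :
    (ρ.frameEquiv b).toLinearEquiv = b.equivFun.symm := rfl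

/-- **Discharge of `ContinuousRep.exists_framedRep`.** Every continuous representation of a group
with continuous inversion on a finite free module with its module topology admits a frame: take
`b` the chosen basis `Module.Free.chooseBasis A M` reindexed by `Fin n` (its index type is finite by
`Module.Free.ChooseBasisIndex.fintype`; no rank condition on `A` is needed), `ρ' := ρ.frame b` and
the equivalence `ρ.frameEquiv b`.
(Folklore; Serre, *Abelian ℓ-adic representations and elliptic curves* (1968), Ch. I §1.1;
FLT `GaloisRep.frame`.) [folklore] -/
theorem exists_framedRep_holds : exists_framedRep (G := G) (A := A) (M := M) := by
  intro _ _ _ _ ρ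
  let b : Module.Basis (Fin (Fintype.card (Module.Free.ChooseBasisIndex A M))) A M :=
    (Module.Free.chooseBasis A M).reindex (Fintype.equivFin _)
  exact ⟨_, ρ.frame b, ⟨ρ.frameEquiv b⟩⟩

end ContinuousRep

end ExistsProof

end Literature.NumberTheory.GaloisRepresentations
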